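import Mathlib
import HarnessLib
import Summits.Ventures.LatticeQCDFlow.Exactness.NCMCGeneralSpaceOccupancyChainMixing

/-!
# The NCMC lane from EVERY initial configuration: occupancy, `dF_occ` and target-level means — assembled

HONEST FRAMING: exact (Metropolis-corrected) sampling algorithms for lattice gauge theory;
figures of merit are autocorrelation/cost numbers at stated couplings and volumes; no
continuum-physics claim.

Venture `LatticeQCDFlow` (cell pub-lqcd), topic `Exactness`; FANOUT row 13 (`eng-snf`, GEN-18).
NEW WORK of the cell, not a published result; no definition is introduced; nothing is cited as a
fact.  Continuation of `NCMCGeneralSpaceOccupancyChainMixing.lean` (two-step Doeblin minorisation of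
the iteration kernel `Q = switchKernel κF κR c W s e ∘ₖ levelKernel T₀ T₁` of `latflow-snf`'s
`run_ncmc_chain` ⇒ Liouville ⇒ every start).  GEN-17 had these statements for `ν₀`-ALMOST EVERY
initial configuration only (`NCMCGeneralSpaceOccupancyChainStart.lean`).

## Content

* §1 **`CrooksPair.ncmc_targetLevelMean_everyStart_of_sq`** — for ANY two-step minorisation
  `ε • ν ≤ nHit Q 2 z` (`ε ≠ 0`): for every measurable `ν₁`-integrable observable `g` of the
  configuration and EVERY initial state `z`, the plain average of `g` over the target-level visits
  converges to `Z₁⁻¹ ∫ g dν₁` almost surely (two Cesàro averages from every start, then the ratio).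
* §2 THE ASSEMBLED STATEMENTS under the prior-level regeneration of
  `NCMCGeneralSpaceOccupancyChainDoeblin.ncmc_sq_doeblin_prior`: Crooks pair between finite non-zero
  weights; level samplers leaving `ν₀`, `ν₁` invariant with `m₀ ≤ T₀(x, ·)`, `m₁ ≤ T₁(y, ·)` from
  every configuration (`m₀` finite, `m₁ ≠ 0`); the forward switch rejected with positive `m₀`-mass
  (`∫ (1 − F_c(x', Ω)) dm₀ ≠ 0`, read in `…Mixing` §1).  **`CrooksPair.ncmc_dFocc_everyStart`** — from
  EVERY initial state: `p̂_n → σ(c − ΔF)` and `dF_occ,n → ΔF` a.s.;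
  **`CrooksPair.ncmc_targetLevelMean_everyStart`** — target-level means from every initial state;
  **`CrooksPair.ncmc_occupancyAverage_bias_le`** — `|E p̂_n − σ(c − ΔF)| ≤ 2/(ε n)` from any initial
  law with the explicit constant `ε = min(ρ₀, α₁) ρ₀`; **`CrooksPair.ncmc_invariant_unique`** — `π_c`
  is the only invariant probability law.

NOT CLAIMED: the mirror assembly (target-level regeneration, `∫ (1 − R_c) dm₁ ≠ 0`) — it is the
same text with `ncmc_sq_minorised_target`; degenerate protocols; anything numerical.
-/

namespace Summit.Ventures.LatticeQCDFlow.Exactness.GeneralNCMC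

open MeasureTheory ProbabilityTheory Set Filter Finset
open scoped ENNReal Topology

variable {Ω E : Type*} [MeasurableSpace Ω] [MeasurableSpace E]

/-! ## §1 Target-level means from every start -/

section Means

variable {ν₀ ν₁ : Measure Ω} [IsFiniteMeasure ν₀] [IsFiniteMeasure ν₁]
  {κF κR : Kernel Ω E} [IsMarkovKernel κF] [IsMarkovKernel κR] {s e : E → Ω} {W : E → ℝ} {c : ℝ}
  {T₀ T₁ : Kernel Ω Ω} [IsMarkovKernel T₀] [IsMarkovKernel T₁] {ε : ℝ≥0∞}
  {ν : Measure (Bool × Ω)} [IsProbabilityMeasure ν]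

/-- **TARGET-LEVEL MEANS CONVERGE FROM EVERY INITIAL STATE**: for every measurable `ν₁`-integrable
observable `g` of the configuration and every `z`, the plain average of `g` over the target-level
visits converges to `Z₁⁻¹ ∫ g dν₁` almost surely along the chain started at `z`. -/
theorem CrooksPair.ncmc_targetLevelMean_everyStart_of_sq (h : CrooksPair ν₀ ν₁ κF κR s e W)
    (h0 : ν₀ univ ≠ 0) (h1 : ν₁ univ ≠ 0) (hT₀ : Kernel.Invariant T₀ ν₀)
    (hT₁ : Kernel.Invariant T₁ ν₁) (hε : ε ≠ 0)
    (hD : haveI := isMarkovKernel_switchKernel (κF := κF) (κR := κR) (c := c)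
              h.measurable_W h.measurable_s h.measurable_e
      ∀ z, ε • ν ≤ nHit (switchKernel κF κR c W s e ∘ₖ levelKernel T₀ T₁) 2 z)
    {g : Ω → ℝ} (hgm : Measurable g) (hg : Integrable g ν₁) (z : Bool × Ω) :
    haveI := isMarkovKernel_switchKernel (κF := κF) (κR := κR) (c := c)
      h.measurable_W h.measurable_s h.measurable_e
    haveI := isMarkovKernel_levelKernel T₀ T₁
    ∀ᵐ x ∂(Kernel.trajMeasure (X := fun _ : ℕ => Bool × Ω) (Measure.dirac z)
        (fun n : ℕ => (switchKernel κF κR c W s e ∘ₖ levelKernel T₀ T₁).comap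
          (fun hh : (j : ↥(Finset.Iic n)) → Bool × Ω => hh ⟨n, Finset.mem_Iic.2 le_rfl⟩)
          (measurable_pi_apply _))),
      Tendsto (fun n : ℕ =>
          (∑ i ∈ range n, (targetLevel Ω).indicator (fun p : Bool × Ω => g p.2) (x i)) /
            ∑ i ∈ range n, (targetLevel Ω).indicator (1 : Bool × Ω → ℝ) (x i))
        atTop (𝓝 (((ν₁ univ).toReal)⁻¹ * ∫ y, g y ∂ν₁)) := by
  haveI := isMarkovKernel_switchKernel (κF := κF) (κR := κR) (c := c)
    h.measurable_W h.measurable_s h.measurable_e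
  haveI := isMarkovKernel_levelKernel T₀ T₁
  haveI := isProbabilityMeasure_jointLaw c ν₀ ν₁ h0
  haveI := isFiniteMeasure_jointWeight c ν₀ ν₁
  have hinv := invariant_smul _ (iteration_invariant h hT₀ hT₁ c) (jointWeight c ν₀ ν₁ univ)⁻¹
  -- the two Cesàro averages, from every start
  have hmeas : Measurable ((targetLevel Ω).indicator fun p : Bool × Ω => g p.2) :=
    (hgm.comp measurable_snd).indicator measurableSet_targetLevel
  have hint : Integrable ((targetLevel Ω).indicator fun p : Bool × Ω => g p.2)
      ((jointWeight c ν₀ ν₁ univ)⁻¹ • jointWeight c ν₀ ν₁) := by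
    refine Integrable.smul_measure ?_ (ENNReal.inv_ne_top.2 (jointWeight_univ_ne_zero c ν₀ ν₁ h0))
    have h0f : (fun x => (targetLevel Ω).indicator (fun p : Bool × Ω => g p.2) (false, x)) =
        fun _ => 0 := by
      funext x; exact Set.indicator_of_notMem (by simp) _
    have h1f : (fun y => (targetLevel Ω).indicator (fun p : Bool × Ω => g p.2) (true, y)) = g := by
      funext y; exact Set.indicator_of_mem (by simp) _
    have hi0 : Integrable ((targetLevel Ω).indicator fun p : Bool × Ω => g p.2)
        (ν₀.map (Prod.mk false)) :=
      (integrable_map_measure hmeas.aestronglyMeasurable measurable_prodMk_left.aemeasurable).2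
        (by rw [show ((targetLevel Ω).indicator fun p : Bool × Ω => g p.2) ∘ Prod.mk false =
          fun _ => 0 from h0f]; exact integrable_const 0)
    have hi1 : Integrable ((targetLevel Ω).indicator fun p : Bool × Ω => g p.2)
        (ν₁.map (Prod.mk true)) :=
      (integrable_map_measure hmeas.aestronglyMeasurable measurable_prodMk_left.aemeasurable).2
        (by rw [show ((targetLevel Ω).indicator fun p : Bool × Ω => g p.2) ∘ Prod.mk true = g
          from h1f]; exact hg)
    rw [jointWeight]
    exact hi0.add_measure (hi1.smul_measure ENNReal.ofReal_ne_top)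
  have hA := tendsto_sum_div_everyStart_of_nHit_minorised hinv hε hD hmeas hint z
  have hB := tendsto_sum_div_everyStart_of_nHit_minorised hinv hε hD
    (targetLevel_indicator_mem (Ω := Ω)).1
    ((memLp_targetLevel_indicator c ν₀ ν₁).integrable one_le_two) z
  -- the population values
  have hJ : 0 < (jointWeight c ν₀ ν₁ univ).toReal :=
    ENNReal.toReal_pos (jointWeight_univ_ne_zero c ν₀ ν₁ h0) (measure_ne_top _ _)
  have hz1 : 0 < (ν₁ univ).toReal := ENNReal.toReal_pos h1 (measure_ne_top ν₁ univ)
  have ha : ∫ p, (targetLevel Ω).indicator (fun p : Bool × Ω => g p.2) p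
      ∂((jointWeight c ν₀ ν₁ univ)⁻¹ • jointWeight c ν₀ ν₁) =
      ((jointWeight c ν₀ ν₁ univ).toReal)⁻¹ * (Real.exp c * ∫ y, g y ∂ν₁) := by
    rw [integral_jointLaw, integral_jointWeight_targetLevel_indicator c ν₀ ν₁ hgm hg]
  have hb : ∫ p, (targetLevel Ω).indicator (1 : Bool × Ω → ℝ) p
      ∂((jointWeight c ν₀ ν₁ univ)⁻¹ • jointWeight c ν₀ ν₁) =
      ((jointWeight c ν₀ ν₁ univ).toReal)⁻¹ * (Real.exp c * (ν₁ univ).toReal) := by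
    rw [integral_indicator_one measurableSet_targetLevel, measureReal_def, Measure.smul_apply,
      smul_eq_mul, ENNReal.toReal_mul, ENNReal.toReal_inv, jointWeight_targetLevel,
      ENNReal.toReal_mul, ENNReal.toReal_ofReal (Real.exp_pos c).le]
  have hb0 : ∫ p, (targetLevel Ω).indicator (1 : Bool × Ω → ℝ) p
      ∂((jointWeight c ν₀ ν₁ univ)⁻¹ • jointWeight c ν₀ ν₁) ≠ 0 := by
    rw [hb]; positivity
  filter_upwards [hA, hB] with x hxA hxB
  have hsum : ∀ n : ℕ,
      (∑ i ∈ range n, (targetLevel Ω).indicator (fun p : Bool × Ω => g p.2) (x i)) /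
          ∑ i ∈ range n, (targetLevel Ω).indicator (1 : Bool × Ω → ℝ) (x i) =
        (∑ i ∈ range n, (targetLevel Ω).indicator (fun p : Bool × Ω => g p.2) (x i)) / n /
          ((∑ i ∈ range n, (targetLevel Ω).indicator (1 : Bool × Ω → ℝ) (x i)) / n) := by
    intro n
    rcases Nat.eq_zero_or_pos n with hn | hn
    · subst hn; simp
    · have hn' : (n : ℝ) ≠ 0 := by exact_mod_cast hn.ne'
      rw [div_div_div_cancel_right₀ hn']
  have hlim := hxA.div hxB hb0
  rw [ha, hb, show ((jointWeight c ν₀ ν₁ univ).toReal)⁻¹ * (Real.exp c * ∫ y, g y ∂ν₁) /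
      (((jointWeight c ν₀ ν₁ univ).toReal)⁻¹ * (Real.exp c * (ν₁ univ).toReal)) =
      ((ν₁ univ).toReal)⁻¹ * ∫ y, g y ∂ν₁ by
        have hec : Real.exp c ≠ 0 := Real.exp_ne_zero c
        field_simp] at hlim
  exact hlim.congr fun n => (hsum n).symm


end Means

/-! ## §2 The assembled statements under the prior-level regeneration -/

section Assembled

variable {ν₀ ν₁ : Measure Ω} [IsFiniteMeasure ν₀] [IsFiniteMeasure ν₁]
  {κF κR : Kernel Ω E} [IsMarkovKernel κF] [IsMarkovKernel κR] {s e : E → Ω} {W : E → ℝ}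
  {T₀ T₁ : Kernel Ω Ω} [IsMarkovKernel T₀] [IsMarkovKernel T₁] {m₀ m₁ : Measure Ω}
  [IsFiniteMeasure m₀]

/-- **`dF_occ` AND THE OCCUPANCY CONVERGE FROM EVERY INITIAL STATE — ASSEMBLED.**  Crooks pair
between finite non-zero weights; level samplers `T₀`, `T₁` leaving `ν₀`, `ν₁` invariant with
`m₀ ≤ T₀(x, ·)`, `m₁ ≤ T₁(y, ·)` from every configuration (`m₀` finite, `m₁ ≠ 0`); the forward
switch rejected with positive `m₀`-mass, `∫ (1 − F_c(x', Ω)) dm₀ ≠ 0`.  Then for EVERY initial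
state `z`, along the NCMC chain started at `z`: `p̂_n → σ(c − ΔF)` and
`c − log(p̂_n/(1 − p̂_n)) → ΔF` almost surely. -/
theorem CrooksPair.ncmc_dFocc_everyStart (h : CrooksPair ν₀ ν₁ κF κR s e W) (h0 : ν₀ univ ≠ 0)
    (h1 : ν₁ univ ≠ 0) (hT₀ : Kernel.Invariant T₀ ν₀) (hT₁ : Kernel.Invariant T₁ ν₁)
    (hm₁ : m₁ univ ≠ 0) (hmin₀ : ∀ x, m₀ ≤ T₀ x) (hmin₁ : ∀ y, m₁ ≤ T₁ y) (c : ℝ)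
    (hρ : ∫⁻ x', (1 - fwdFlow κF c W e x' univ) ∂m₀ ≠ 0)
    {ΔF : ℝ} (hΔF : Real.exp (-ΔF) = ((ν₀ univ)⁻¹ * ν₁ univ).toReal) (z : Bool × Ω) :
    haveI := isMarkovKernel_switchKernel (κF := κF) (κR := κR) (c := c)
      h.measurable_W h.measurable_s h.measurable_e
    haveI := isMarkovKernel_levelKernel T₀ T₁
    ∀ᵐ x ∂(Kernel.trajMeasure (X := fun _ : ℕ => Bool × Ω) (Measure.dirac z)
        (fun n : ℕ => (switchKernel κF κR c W s e ∘ₖ levelKernel T₀ T₁).comap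
          (fun hh : (j : ↥(Finset.Iic n)) → Bool × Ω => hh ⟨n, Finset.mem_Iic.2 le_rfl⟩)
          (measurable_pi_apply _))),
      Tendsto (fun n : ℕ => (∑ i ∈ range n, (targetLevel Ω).indicator (1 : Bool × Ω → ℝ) (x i)) / n)
          atTop (𝓝 (Real.sigmoid (c - ΔF))) ∧
        Tendsto (fun n : ℕ => c - Real.log
            ((∑ i ∈ range n, (targetLevel Ω).indicator (1 : Bool × Ω → ℝ) (x i)) / n /
              (1 - (∑ i ∈ range n, (targetLevel Ω).indicator (1 : Bool × Ω → ℝ) (x i)) / n)))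
          atTop (𝓝 ΔF) := by
  haveI := isProbabilityMeasure_rejPrior_normalised (κF := κF) (c := c) (e := e) (m₀ := m₀) hρ
  have hD := ncmc_nHit_two_doeblin (κR := κR) (s := s) (T₀ := T₀) (T₁ := T₁) (m₁ := m₁)
    h.measurable_W h.measurable_s h.measurable_e hmin₀ hmin₁ hρ
  have hε := ncmc_sq_doeblin_const_ne_zero (κR := κR) (s := s) (e := e) (c := c)
    h.measurable_W h.measurable_s hm₁ hρ
  filter_upwards [h.ncmc_occupancy_everyStart_of_sq h0 h1 hT₀ hT₁ hε hD hΔF z,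
    h.ncmc_dFocc_everyStart_of_sq h0 h1 hT₀ hT₁ hε hD hΔF z] with x hx1 hx2
  exact ⟨hx1, hx2⟩

/-- **The burn-in bound with the explicit constant**: from any initial law,
`|E p̂_n − σ(c − ΔF)| ≤ 2/(ε n)` with `ε = min(ρ₀, α₁) ρ₀`, `ρ₀ = ∫ (1 − F_c(x', Ω)) dm₀`,
`α₁ = ∫ R_c(y', Ω) dm₁`. -/
theorem CrooksPair.ncmc_occupancyAverage_bias_le (h : CrooksPair ν₀ ν₁ κF κR s e W)
    (h0 : ν₀ univ ≠ 0) (h1 : ν₁ univ ≠ 0) (hT₀ : Kernel.Invariant T₀ ν₀)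
    (hT₁ : Kernel.Invariant T₁ ν₁) (hm₁ : m₁ univ ≠ 0) (hmin₀ : ∀ x, m₀ ≤ T₀ x)
    (hmin₁ : ∀ y, m₁ ≤ T₁ y) (c : ℝ) (hρ : ∫⁻ x', (1 - fwdFlow κF c W e x' univ) ∂m₀ ≠ 0)
    {ΔF : ℝ} (hΔF : Real.exp (-ΔF) = ((ν₀ univ)⁻¹ * ν₁ univ).toReal)
    (μ₀ : Measure (Bool × Ω)) [IsProbabilityMeasure μ₀] {n : ℕ} (hn : n ≠ 0) :
    haveI := isMarkovKernel_switchKernel (κF := κF) (κR := κR) (c := c)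
      h.measurable_W h.measurable_s h.measurable_e
    haveI := isMarkovKernel_levelKernel T₀ T₁
    |∫ x, (∑ i ∈ range n, (targetLevel Ω).indicator (1 : Bool × Ω → ℝ) (x i)) / n
        ∂(Kernel.trajMeasure (X := fun _ : ℕ => Bool × Ω) μ₀
          (fun n : ℕ => (switchKernel κF κR c W s e ∘ₖ levelKernel T₀ T₁).comap
            (fun hh : (j : ↥(Finset.Iic n)) → Bool × Ω => hh ⟨n, Finset.mem_Iic.2 le_rfl⟩)
            (measurable_pi_apply _))) - Real.sigmoid (c - ΔF)| ≤
      2 / ((min (∫⁻ x', (1 - fwdFlow κF c W e x' univ) ∂m₀) (∫⁻ y', revFlow κR c W s y' univ ∂m₁) *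
        ∫⁻ x', (1 - fwdFlow κF c W e x' univ) ∂m₀).toReal * n) := by
  haveI := isProbabilityMeasure_rejPrior_normalised (κF := κF) (c := c) (e := e) (m₀ := m₀) hρ
  have hD := ncmc_nHit_two_doeblin (κR := κR) (s := s) (T₀ := T₀) (T₁ := T₁) (m₁ := m₁)
    h.measurable_W h.measurable_s h.measurable_e hmin₀ hmin₁ hρ
  have hε := ncmc_sq_doeblin_const_ne_zero (κR := κR) (s := s) (e := e) (c := c)
    h.measurable_W h.measurable_s hm₁ hρ
  exact h.ncmc_occupancyAverage_bias_le_of_sq h0 h1 hT₀ hT₁ hε hD hΔF μ₀ hn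

/-- **Target-level means from every initial state — assembled.** -/
theorem CrooksPair.ncmc_targetLevelMean_everyStart (h : CrooksPair ν₀ ν₁ κF κR s e W)
    (h0 : ν₀ univ ≠ 0) (h1 : ν₁ univ ≠ 0) (hT₀ : Kernel.Invariant T₀ ν₀)
    (hT₁ : Kernel.Invariant T₁ ν₁) (hm₁ : m₁ univ ≠ 0) (hmin₀ : ∀ x, m₀ ≤ T₀ x)
    (hmin₁ : ∀ y, m₁ ≤ T₁ y) (c : ℝ) (hρ : ∫⁻ x', (1 - fwdFlow κF c W e x' univ) ∂m₀ ≠ 0)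
    {g : Ω → ℝ} (hgm : Measurable g) (hg : Integrable g ν₁) (z : Bool × Ω) :
    haveI := isMarkovKernel_switchKernel (κF := κF) (κR := κR) (c := c)
      h.measurable_W h.measurable_s h.measurable_e
    haveI := isMarkovKernel_levelKernel T₀ T₁
    ∀ᵐ x ∂(Kernel.trajMeasure (X := fun _ : ℕ => Bool × Ω) (Measure.dirac z)
        (fun n : ℕ => (switchKernel κF κR c W s e ∘ₖ levelKernel T₀ T₁).comap
          (fun hh : (j : ↥(Finset.Iic n)) → Bool × Ω => hh ⟨n, Finset.mem_Iic.2 le_rfl⟩)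
          (measurable_pi_apply _))),
      Tendsto (fun n : ℕ =>
          (∑ i ∈ range n, (targetLevel Ω).indicator (fun p : Bool × Ω => g p.2) (x i)) /
            ∑ i ∈ range n, (targetLevel Ω).indicator (1 : Bool × Ω → ℝ) (x i))
        atTop (𝓝 (((ν₁ univ).toReal)⁻¹ * ∫ y, g y ∂ν₁)) := by
  haveI := isProbabilityMeasure_rejPrior_normalised (κF := κF) (c := c) (e := e) (m₀ := m₀) hρ
  have hD := ncmc_nHit_two_doeblin (κR := κR) (s := s) (T₀ := T₀) (T₁ := T₁) (m₁ := m₁)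
    h.measurable_W h.measurable_s h.measurable_e hmin₀ hmin₁ hρ
  have hε := ncmc_sq_doeblin_const_ne_zero (κR := κR) (s := s) (e := e) (c := c)
    h.measurable_W h.measurable_s hm₁ hρ
  exact h.ncmc_targetLevelMean_everyStart_of_sq h0 h1 hT₀ hT₁ hε hD hgm hg z

/-- **`π_c` is the only invariant probability law of the NCMC iteration kernel — assembled.** -/
theorem CrooksPair.ncmc_invariant_unique (h : CrooksPair ν₀ ν₁ κF κR s e W) (h0 : ν₀ univ ≠ 0)
    (hT₀ : Kernel.Invariant T₀ ν₀) (hT₁ : Kernel.Invariant T₁ ν₁) (hm₁ : m₁ univ ≠ 0)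
    (hmin₀ : ∀ x, m₀ ≤ T₀ x) (hmin₁ : ∀ y, m₁ ≤ T₁ y) (c : ℝ)
    (hρ : ∫⁻ x', (1 - fwdFlow κF c W e x' univ) ∂m₀ ≠ 0)
    {π' : Measure (Bool × Ω)} [IsProbabilityMeasure π']
    (hπ' : haveI := isMarkovKernel_switchKernel (κF := κF) (κR := κR) (c := c)
              h.measurable_W h.measurable_s h.measurable_e
      Kernel.Invariant (switchKernel κF κR c W s e ∘ₖ levelKernel T₀ T₁) π') :
    π' = (jointWeight c ν₀ ν₁ univ)⁻¹ • jointWeight c ν₀ ν₁ := by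
  haveI := isProbabilityMeasure_rejPrior_normalised (κF := κF) (c := c) (e := e) (m₀ := m₀) hρ
  have hD := ncmc_nHit_two_doeblin (κR := κR) (s := s) (T₀ := T₀) (T₁ := T₁) (m₁ := m₁)
    h.measurable_W h.measurable_s h.measurable_e hmin₀ hmin₁ hρ
  have hε := ncmc_sq_doeblin_const_ne_zero (κR := κR) (s := s) (e := e) (c := c)
    h.measurable_W h.measurable_s hm₁ hρ
  exact h.ncmc_invariant_unique_of_sq h0 hT₀ hT₁ hε hD hπ'

end Assembled

end Summit.Ventures.LatticeQCDFlow.Exactness.GeneralNCMC
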